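import Summits.NavierStokesRegularity.NavierStokesRegularity.Theorems.LerayQuarterDissipationFiniteDissipationLiouvilleSliceLSix
import Literature.Analysis.FluidPDE.TypeIAncientMildClassical
import Literature.Analysis.FluidPDE.PineauVicolRSSChaeWolf
import Literature.Analysis.FluidPDE.ChaeWolfDSSUniformEnergy
import Literature.Analysis.FluidPDE.ClassicalLqRatePressure
import Literature.Analysis.FluidPDE.NSVelocityUniqueness
import HarnessLib

/-!
# Crux `FiniteDissipationLiouville` (stmt-NavierStokesRegularity-22144): the local energy classes
# of a member of the finite-dissipation stratum up to the apex time (file 1/3 of the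
# final-slice leaf)

Theorems file of route `LerayQuarterDissipation` (lead prover g3; `--supports` the crux). Navier–Stokes
regularity is NOT proved by anything here; no summit is.

A member of the stratum `𝒟` — a Type-I ancient mild field `u` in the KNSS gauge
(`IsTypeIAncientMild C u`) with Leray's quarter-rate dissipation law `∫ ‖∇u(s)‖² ≤ K/√(−s)` — is a
classical solution of Navier–Stokes on `(−∞, 0) × ℝ³` for one smooth pressure (Fabes–Jones–Rivière
on the windows, patched), and its slices lie in `L⁶` AT THE TYPE-I RATE
`‖u(t)‖_{L⁶} ≤ A (−t)^{−1/4}` (`memLp_six_slice`, lead g0: the gauge kills the Sobolev constant).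
This is exactly Chae–Wolf's subcritical-rate hypothesis (2.4a) with `q = 6`, `κ = (q−3)/(2q) = 1/4`,
`3κ < 1`, so the tree's rendering of Chae–Wolf 2017, §2 Step 2 applies verbatim and gives the LOCAL
ENERGY CLASSES UP TO THE APEX TIME, uniformly in the centre:

* `exists_isClassicalNSSolutionOn_Iio` — one pressure on the whole past;
* `exists_eLpNorm_six_rate` — (2.4a) with `q = 6`: `‖u(t)‖₆ ≤ A(−t)^{−1/4}`;
* `exists_scaledEnergy_bound` — Albritton–Barker's `A(r; (0,x₀)) ≤ Λ` and `E(r; (0,x₀)) ≤ Λ` at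
  EVERY top point `(0, x₀)` and EVERY scale `r > 0` (`ChaeWolfDecay.exists_scaleInvariant_energy_bound`);
* `exists_forall_lintegral_ball_sq_le` — unwound: `∫_{B(x₀,R)} |u(t)|² ≤ M` for ALL `t ∈ (−T, 0)`
  and ALL centres `x₀` (the `(L^∞_t L²_x)_{uloc}` class of Lemarié-Rieusset's local Leray solutions,
  THROUGH the singular time; the essential supremum is upgraded to every time by the continuity of
  `t ↦ ∫_{B} |u(t)|²` below the apex);
* `lintegral_slab_frobenius_le` — `∫₋ₜ⁰ ∫_{ℝ³} |∇u|² ≤ 6 K⁺ √T` (the law integrated in time).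

These are the clauses of the local Leray class that do not involve the pressure; the pressure class
(`…ApexPressure.lean`, file 2/3) and the assembly with the final-slice leaf (`…FinalSlice.lean`,
file 3/3: a member of `𝒟` whose slices tend to `0` in `𝒟'(ℝ³)` as `t → 0⁻` vanishes identically,
by Lemarié-Rieusset's backward uniqueness for local Leray solutions) follow.

References: D. Chae, J. Wolf, arXiv:1610.09464, §2 Step 2 (2.4a)–(2.4c); P. G. Lemarié-Rieusset,
*The Navier–Stokes Problem in the 21st Century* (2016), Def. 14.1; Koch–Nadirashvili–Seregin–Šverák,
Acta Math. 203 (2009), §4.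
-/

noncomputable section

-- the summit and its single sub-problem share the name (CONVENTIONS §1), as in every Theorems file
set_option linter.dupNamespace false

namespace Summit.NavierStokesRegularity.NavierStokesRegularity.Theorems.FiniteDissipationLiouville.Birth.Apex

open MeasureTheory Set Filter Topology Metric Function
open Literature.Analysis Literature.Analysis.FluidPDE
open scoped ENNReal NNReal

variable {C K : ℝ} {u : ℝ → EuclideanSpace ℝ (Fin 3) → EuclideanSpace ℝ (Fin 3)}

/-! ### One pressure on the whole past -/

/-- **A member of the KNSS-gauge Type-I class is a classical Navier–Stokes solution on
`(−∞, 0) × ℝ³` for one smooth pressure** (classical on the windows `(−(k+1), 0)` by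
`IsTypeIAncientMild.exists_isClassicalNSSolutionOn_Ioo`, Fabes–Jones–Rivière; patched after
normalisation at the origin by `IsClassicalNSSolutionOn.exists_pressure_Iio_of_Ioo`). -/
theorem exists_isClassicalNSSolutionOn_Iio (hu : IsTypeIAncientMild C u) :
    ∃ p : ℝ → EuclideanSpace ℝ (Fin 3) → ℝ, IsClassicalNSSolutionOn (Iio 0) 1 0 u p := by
  have hwin : ∀ k : ℕ, ∃ q : ℝ → EuclideanSpace ℝ (Fin 3) → ℝ,
      IsClassicalNSSolutionOn (Ioo (-((k : ℝ) + 1)) 0) 1 0 u q := fun k =>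
    hu.exists_isClassicalNSSolutionOn_Ioo (t₀ := -((k : ℝ) + 1)) (by
      have : (0 : ℝ) ≤ k := Nat.cast_nonneg k
      linarith)
  choose q hq using hwin
  refine IsClassicalNSSolutionOn.exists_pressure_Iio_of_Ioo (a := fun k : ℕ => -((k : ℝ) + 1)) hq
    fun s _ => ⟨⌈-s⌉₊, ?_⟩
  have h1 : -s ≤ (⌈-s⌉₊ : ℝ) := Nat.le_ceil (-s)
  show -((⌈-s⌉₊ : ℝ) + 1) < s
  linarith

/-! ### The `L⁶` rate of the slices (Chae–Wolf's (2.4a) with `q = 6`) -/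

/-- `√(a/√s) = √a · s^{-1/4}` for `0 < s`. -/
theorem sqrt_div_sqrt_eq_mul_rpow (a : ℝ) {s : ℝ} (hs : 0 < s) :
    Real.sqrt (a / Real.sqrt s) = Real.sqrt a * s ^ (-(1 / 4 : ℝ)) := by
  rw [Real.sqrt_div' _ (Real.sqrt_nonneg s), Real.sqrt_eq_rpow, Real.sqrt_eq_rpow,
    Real.sqrt_eq_rpow, ← Real.rpow_mul hs.le, Real.rpow_neg hs.le, div_eq_mul_inv]
  norm_num

/-- **The slices of a member of the stratum lie in `L⁶` at the Type-I rate**: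
`‖u(t)‖_{L⁶} ≤ A (−t)^{−1/4}` with `A = C_L √(K⁺)` (`memLp_six_slice`, lead g0), written with the
exponent `−(q−3)/(2q)`, `q = 6`, of Chae–Wolf's (2.4a). -/
theorem exists_eLpNorm_six_rate (hu : IsTypeIAncientMild C u)
    (hlaw : ∀ s : ℝ, s < 0 → ∫⁻ x, ‖fderiv ℝ (u s) x‖ₑ ^ 2 ≤ ENNReal.ofReal (K / Real.sqrt (-s))) :
    ∃ A : ℝ, 0 ≤ A ∧ ∀ t < 0, MemLp (u t) (ENNReal.ofReal 6) volume ∧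
      eLpNorm (u t) (ENNReal.ofReal 6) volume ≤
        ENNReal.ofReal (A * (-t) ^ (-((6 - 3) / (2 * 6) : ℝ))) := by
  obtain ⟨CL, hCL, h⟩ := memLp_six_slice
  have e6 : ENNReal.ofReal (6 : ℝ) = 6 := by norm_num
  refine ⟨CL * Real.sqrt (max K 0), by positivity, fun t ht => ?_⟩
  obtain ⟨hmem, hN⟩ := h C K u hu hlaw t ht
  have ht0 : 0 < -t := neg_pos.2 ht
  rw [e6]
  refine ⟨hmem, ?_⟩
  rw [hmem.eLpNorm_eq_integral_rpow_norm (by norm_num) (by norm_num)]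
  refine ENNReal.ofReal_le_ofReal ?_
  have e1 : (6 : ℝ≥0∞).toReal = 6 := by norm_num
  have e2 : ((6 : ℝ≥0∞).toReal)⁻¹ = (1 / 6 : ℝ) := by norm_num
  rw [e2, e1]
  refine hN.trans (le_of_eq ?_)
  rw [sqrt_div_sqrt_eq_mul_rpow _ ht0, mul_assoc]
  norm_num

/-! ### The scale-invariant energy bounds at every top point (Chae–Wolf (2.17)) -/

/-- **Albritton–Barker's `A` and `E` are bounded at every top point and every scale.** For a member
of the stratum there is `Λ` with `A(r; (0, x₀)) ≤ Λ` and `E(r; (0, x₀)) ≤ Λ` for all `x₀` and all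
`r > 0` (`ChaeWolfDecay.exists_scaleInvariant_energy_bound` with `q = 6`, fed with
`exists_eLpNorm_six_rate` and `exists_isClassicalNSSolutionOn_Iio`). -/
theorem exists_scaledEnergy_bound (hu : IsTypeIAncientMild C u)
    (hlaw : ∀ s : ℝ, s < 0 → ∫⁻ x, ‖fderiv ℝ (u s) x‖ₑ ^ 2 ≤ ENNReal.ofReal (K / Real.sqrt (-s))) :
    ∃ Λ : ℝ≥0, ∀ (x₀ : EuclideanSpace ℝ (Fin 3)) (r : ℝ), 0 < r →
      cknAEss r ((0 : ℝ), x₀) u ≤ Λ ∧ cknE r ((0 : ℝ), x₀) (fun t x => fderiv ℝ (u t) x) ≤ Λ := by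
  obtain ⟨A, hA0, hA⟩ := exists_eLpNorm_six_rate hu hlaw
  obtain ⟨p, hp⟩ := exists_isClassicalNSSolutionOn_Iio hu
  obtain ⟨Λ, hΛ⟩ := ChaeWolfDecay.exists_scaleInvariant_energy_bound (q := 6) (by norm_num) hA0
  exact ⟨Λ, fun x₀ r hr => hΛ u p hp (fun t ht => (hA t ht).1) (fun t ht => (hA t ht).2) x₀ r hr⟩

/-- **The `(L^∞_t L²_x)_{uloc}` class through the apex.** For a member of the stratum and
`R, T > 0` there is `M` with `∫_{B(x₀,R)} |u(t)|² ≤ M` for a.e. `t ∈ (−T, 0)` and ALL centres `x₀`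
(from `A(r; (0, q)) ≤ Λ` at the scale `r = 2R + √T` and the centres `q` of a countable dense set:
`B(x₀, R) ⊆ B(q, r)` for `q` within `R` of `x₀`). -/
theorem exists_ae_forall_lintegral_ball_sq_le (hu : IsTypeIAncientMild C u)
    (hlaw : ∀ s : ℝ, s < 0 → ∫⁻ x, ‖fderiv ℝ (u s) x‖ₑ ^ 2 ≤ ENNReal.ofReal (K / Real.sqrt (-s)))
    {R T : ℝ} (hR : 0 < R) (hT : 0 < T) :
    ∃ M : ℝ≥0, ∀ᵐ t ∂(volume.restrict (Ioo (-T) 0)), ∀ x₀ : EuclideanSpace ℝ (Fin 3),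
      ∫⁻ x in ball x₀ R, ‖u t x‖ₑ ^ 2 ≤ M := by
  obtain ⟨Λ, hΛ⟩ := exists_scaledEnergy_bound hu hlaw
  set r : ℝ := 2 * R + Real.sqrt T with hr
  have hr0 : 0 < r := by have := Real.sqrt_nonneg T; rw [hr]; linarith
  have hTr : T ≤ r ^ 2 := by
    have h1 : Real.sqrt T ≤ r := by rw [hr]; linarith
    calc T = Real.sqrt T ^ 2 := (Real.sq_sqrt hT.le).symm
      _ ≤ r ^ 2 := pow_le_pow_left₀ (Real.sqrt_nonneg T) h1 2
  have hrne : ENNReal.ofReal r ≠ 0 := (ENNReal.ofReal_pos.2 hr0).ne'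
  obtain ⟨S, hSc, hSd⟩ := TopologicalSpace.exists_countable_dense (EuclideanSpace ℝ (Fin 3))
  -- the bound at the centres of `S`
  have key : ∀ q ∈ S, ∀ᵐ t ∂(volume.restrict (Ioo (-r ^ 2) 0)),
      ∫⁻ x in ball q r, ‖u t x‖ₑ ^ 2 ≤ ENNReal.ofReal r * Λ := by
    intro q _
    have h1 := (hΛ q r hr0).1
    unfold cknAEss at h1
    simp only [zero_sub] at h1
    have h2 := ENNReal.ae_le_essSup (μ := volume.restrict (Ioo (-r ^ 2) (0 : ℝ)))
      (fun t => (ENNReal.ofReal r)⁻¹ * ∫⁻ x in ball q r, ‖u t x‖ₑ ^ 2)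
    filter_upwards [h2] with t ht
    have h3 := ht.trans h1
    calc ∫⁻ x in ball q r, ‖u t x‖ₑ ^ 2
        = ENNReal.ofReal r * ((ENNReal.ofReal r)⁻¹ * ∫⁻ x in ball q r, ‖u t x‖ₑ ^ 2) := by
          rw [← mul_assoc, ENNReal.mul_inv_cancel hrne ENNReal.ofReal_ne_top, one_mul]
      _ ≤ ENNReal.ofReal r * Λ := mul_le_mul_right h3 _
  have hall : ∀ᵐ t ∂(volume.restrict (Ioo (-r ^ 2) 0)), ∀ q ∈ S,
      ∫⁻ x in ball q r, ‖u t x‖ₑ ^ 2 ≤ ENNReal.ofReal r * Λ := (ae_ball_iff hSc).2 key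
  have hsub : Ioo (-T) 0 ⊆ Ioo (-r ^ 2) (0 : ℝ) := Ioo_subset_Ioo (by linarith) le_rfl
  refine ⟨r.toNNReal * Λ, ?_⟩
  filter_upwards [ae_restrict_of_ae_restrict_of_subset hsub hall] with t ht x₀
  obtain ⟨q, hqS, hq⟩ := hSd.exists_dist_lt x₀ hR
  have hballsub : ball x₀ R ⊆ ball q r := by
    intro y hy
    rw [mem_ball] at hy ⊢
    calc dist y q ≤ dist y x₀ + dist x₀ q := dist_triangle _ _ _
      _ < R + R := add_lt_add hy hq
      _ ≤ r := by have := Real.sqrt_nonneg T; rw [hr]; linarith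
  calc ∫⁻ x in ball x₀ R, ‖u t x‖ₑ ^ 2 ≤ ∫⁻ x in ball q r, ‖u t x‖ₑ ^ 2 :=
        lintegral_mono_set hballsub
    _ ≤ ENNReal.ofReal r * Λ := ht q hqS
    _ = ((r.toNNReal * Λ : ℝ≥0) : ℝ≥0∞) := by rw [ENNReal.coe_mul, ENNReal.ofReal]

/-! ### The dissipation through the apex -/

/-- The slice dissipation in Frobenius form: `∫ |∇u(s)|_F² ≤ 3 K⁺/√(−s)`. -/
theorem lintegral_frobenius_slice_le (hlaw : ∀ s : ℝ, s < 0 →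
      ∫⁻ x, ‖fderiv ℝ (u s) x‖ₑ ^ 2 ≤ ENNReal.ofReal (K / Real.sqrt (-s))) {s : ℝ} (hs : s < 0) :
    ∫⁻ x, ENNReal.ofReal (frobeniusNormSq (fderiv ℝ (u s) x)) ≤
      ENNReal.ofReal (3 * (max K 0 * (-s) ^ (-(3 * (1 / 6 : ℝ))))) := by
  have hs0 : 0 < -s := neg_pos.2 hs
  calc ∫⁻ x, ENNReal.ofReal (frobeniusNormSq (fderiv ℝ (u s) x))
      ≤ ∫⁻ x, 3 * ‖fderiv ℝ (u s) x‖ₑ ^ 2 := lintegral_mono fun x => ofReal_frobeniusNormSq_le _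
    _ = 3 * ∫⁻ x, ‖fderiv ℝ (u s) x‖ₑ ^ 2 := by
        rw [lintegral_const_mul' _ _ (by norm_num)]
    _ ≤ 3 * ENNReal.ofReal (K / Real.sqrt (-s)) := mul_le_mul_right (hlaw s hs) _
    _ ≤ 3 * ENNReal.ofReal (max K 0 * (-s) ^ (-(3 * (1 / 6 : ℝ)))) := by
        refine mul_le_mul_right (ENNReal.ofReal_le_ofReal ?_) _
        have e : (-s) ^ (-(3 * (1 / 6 : ℝ))) = (Real.sqrt (-s))⁻¹ := by
          rw [Real.sqrt_eq_rpow, ← Real.rpow_neg hs0.le]; norm_num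
        rw [e, div_eq_mul_inv]
        exact mul_le_mul_of_nonneg_right (le_max_left _ _) (inv_nonneg.2 (Real.sqrt_nonneg _))
    _ = ENNReal.ofReal (3 * (max K 0 * (-s) ^ (-(3 * (1 / 6 : ℝ))))) := by
        conv_rhs => rw [ENNReal.ofReal_mul (by norm_num : (0 : ℝ) ≤ 3), ENNReal.ofReal_ofNat]

/-- **The dissipation is integrable through the apex**: `∫₋ₜ⁰ ∫ |∇u|_F² < ∞` on every slab
`(−T, 0) × ℝ³` (the law `∫|∇u(s)|² ≤ K/√(−s)` integrated in time; the integrand is continuous below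
the apex, so Tonelli applies). -/
theorem lintegral_slab_frobenius_lt_top (hu : IsTypeIAncientMild C u)
    (hlaw : ∀ s : ℝ, s < 0 → ∫⁻ x, ‖fderiv ℝ (u s) x‖ₑ ^ 2 ≤ ENNReal.ofReal (K / Real.sqrt (-s)))
    (T : ℝ) :
    ∫⁻ z in Ioo (-T) 0 ×ˢ (univ : Set (EuclideanSpace ℝ (Fin 3))),
      ENNReal.ofReal (frobeniusNormSq (fderiv ℝ (u z.1) z.2)) < ⊤ := by
  set F : ℝ × EuclideanSpace ℝ (Fin 3) → ℝ≥0∞ := fun z =>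
    ENNReal.ofReal (frobeniusNormSq (fderiv ℝ (u z.1) z.2)) with hF
  -- continuity below the apex
  have hu1 : ContDiffOn ℝ 1 (uncurry u) (Iio 0 ×ˢ univ) := hu.contDiffOn.of_le (by norm_cast)
  have cDu : ContinuousOn (fun z : ℝ × EuclideanSpace ℝ (Fin 3) => fderiv ℝ (u z.1) z.2)
      (Iio 0 ×ˢ univ) := continuousOn_fderiv_slice_of_contDiffOn hu1 isOpen_Iio.uniqueDiffOn
  have cF : ContinuousOn F (Iio 0 ×ˢ univ) :=
    ENNReal.continuous_ofReal.comp_continuousOn (continuous_frobeniusNormSq_clm.comp_continuousOn cDu)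
  have hsub : Ioo (-T) 0 ×ˢ (univ : Set (EuclideanSpace ℝ (Fin 3))) ⊆ Iio 0 ×ˢ univ :=
    prod_mono (fun s hs => (hs.2 : s < 0)) Subset.rfl
  have hvol : ((volume : Measure ℝ).restrict (Ioo (-T) 0)).prod
      (volume : Measure (EuclideanSpace ℝ (Fin 3))) =
      (volume : Measure (ℝ × EuclideanSpace ℝ (Fin 3))).restrict
        (Ioo (-T) 0 ×ˢ (univ : Set (EuclideanSpace ℝ (Fin 3)))) := by
    rw [show (volume : Measure (ℝ × EuclideanSpace ℝ (Fin 3))) =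
        (volume : Measure ℝ).prod (volume : Measure (EuclideanSpace ℝ (Fin 3))) from rfl,
      ← Measure.prod_restrict, Measure.restrict_univ]
  have hFm : AEMeasurable F (((volume : Measure ℝ).restrict (Ioo (-T) 0)).prod
      (volume : Measure (EuclideanSpace ℝ (Fin 3)))) := by
    rw [hvol]
    exact (cF.mono hsub).aemeasurable (measurableSet_Ioo.prod MeasurableSet.univ)
  show ∫⁻ z in Ioo (-T) 0 ×ˢ univ, F z < ⊤
  rw [← hvol, lintegral_prod _ hFm]
  -- the time integrand is dominated by an integrable power
  have hint : IntegrableOn (fun s : ℝ => 3 * (max K 0 * (-s) ^ (-(3 * (1 / 6 : ℝ))))) (Ioo (-T) 0) :=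
    ((ChaeWolfEnergy.integrableOn_rpow_neg_Ioo (by norm_num) _).const_mul _).const_mul _
  calc ∫⁻ s in Ioo (-T) 0, ∫⁻ x, F (s, x)
      ≤ ∫⁻ s in Ioo (-T) 0, ENNReal.ofReal (3 * (max K 0 * (-s) ^ (-(3 * (1 / 6 : ℝ))))) :=
        setLIntegral_mono' measurableSet_Ioo fun s hs => lintegral_frobenius_slice_le hlaw hs.2
    _ = ENNReal.ofReal (∫ s in Ioo (-T) 0, 3 * (max K 0 * (-s) ^ (-(3 * (1 / 6 : ℝ))))) := by
        refine (ofReal_integral_eq_lintegral_ofReal hint ?_).symm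
        refine (ae_restrict_iff' measurableSet_Ioo).2 (ae_of_all _ fun s hs => ?_)
        have : 0 ≤ (-s) ^ (-(3 * (1 / 6 : ℝ))) := Real.rpow_nonneg (by linarith [hs.2]) _
        positivity
    _ < ⊤ := ENNReal.ofReal_lt_top

/-! ### Square integrability through the apex on compact sets -/

/-- The product measure on a time–space box. -/
theorem volume_restrict_prod_eq (I : Set ℝ) (B : Set (EuclideanSpace ℝ (Fin 3))) :
    (volume : Measure (ℝ × EuclideanSpace ℝ (Fin 3))).restrict (I ×ˢ B) =
      ((volume : Measure ℝ).restrict I).prod ((volume : Measure (EuclideanSpace ℝ (Fin 3))).restrict B) := by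
  rw [Measure.volume_eq_prod, Measure.prod_restrict]

/-- `‖u‖²` is continuous below the apex (as an `ℝ≥0∞`-valued space–time function). -/
theorem continuousOn_enorm_sq (hu : IsTypeIAncientMild C u) :
    ContinuousOn (fun z : ℝ × EuclideanSpace ℝ (Fin 3) => ‖u z.1 z.2‖ₑ ^ 2) (Iio 0 ×ˢ univ) := by
  have h1 : ContinuousOn (fun z : ℝ × EuclideanSpace ℝ (Fin 3) => ‖u z.1 z.2‖ₑ) (Iio 0 ×ˢ univ) :=
    continuous_enorm.comp_continuousOn hu.continuousOn_uncurry
  exact (ENNReal.continuous_pow 2).comp_continuousOn h1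

/-- **`u ∈ L²((−T, 0) × K)` for every compact `K`** (square integrability THROUGH the apex; from the
uniformly local energy bound `exists_ae_forall_lintegral_ball_sq_le` and Tonelli). -/
theorem lintegral_slab_compact_sq_lt_top (hu : IsTypeIAncientMild C u)
    (hlaw : ∀ s : ℝ, s < 0 → ∫⁻ x, ‖fderiv ℝ (u s) x‖ₑ ^ 2 ≤ ENNReal.ofReal (K / Real.sqrt (-s)))
    {T : ℝ} (hT : 0 < T) {K' : Set (EuclideanSpace ℝ (Fin 3))} (hK' : IsCompact K') :
    ∫⁻ z in Ioo (-T) 0 ×ˢ K', ‖u z.1 z.2‖ₑ ^ 2 < ⊤ := by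
  obtain ⟨R, hR0, hR⟩ := hK'.isBounded.subset_ball_lt 0 (0 : EuclideanSpace ℝ (Fin 3))
  obtain ⟨M, hM⟩ := exists_ae_forall_lintegral_ball_sq_le hu hlaw hR0 hT
  set F : ℝ × EuclideanSpace ℝ (Fin 3) → ℝ≥0∞ := fun z => ‖u z.1 z.2‖ₑ ^ 2 with hF
  have hsub : Ioo (-T) 0 ×ˢ ball (0 : EuclideanSpace ℝ (Fin 3)) R ⊆ Iio 0 ×ˢ univ :=
    prod_mono (fun s hs => (hs.2 : s < 0)) (subset_univ _)
  have hFm : AEMeasurable F (((volume : Measure ℝ).restrict (Ioo (-T) 0)).prod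
      ((volume : Measure (EuclideanSpace ℝ (Fin 3))).restrict (ball 0 R))) := by
    rw [← volume_restrict_prod_eq]
    exact ((continuousOn_enorm_sq hu).mono hsub).aemeasurable (measurableSet_Ioo.prod measurableSet_ball)
  calc ∫⁻ z in Ioo (-T) 0 ×ˢ K', F z
      ≤ ∫⁻ z in Ioo (-T) 0 ×ˢ ball (0 : EuclideanSpace ℝ (Fin 3)) R, F z :=
        lintegral_mono_set (prod_mono Subset.rfl hR)
    _ = ∫⁻ t in Ioo (-T) 0, ∫⁻ x in ball (0 : EuclideanSpace ℝ (Fin 3)) R, F (t, x) := by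
        rw [volume_restrict_prod_eq, lintegral_prod _ hFm]
    _ ≤ ∫⁻ _ in Ioo (-T) 0, (M : ℝ≥0∞) := lintegral_mono_ae (hM.mono fun t ht => ht 0)
    _ = M * volume (Ioo (-T) (0 : ℝ)) := setLIntegral_const _ _
    _ < ⊤ := ENNReal.mul_lt_top ENNReal.coe_lt_top measure_Ioo_lt_top

end Summit.NavierStokesRegularity.NavierStokesRegularity.Theorems.FiniteDissipationLiouville.Birth.Apex

end
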